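import Summits.BirchSwinnertonDyer.BirchSwinnertonDyer.Theorems.AdditiveBranchIMCGordTwoRankOneHeegnerKolyvaginSmallImage
import Literature.NumberTheory.EllipticCurves.FineSelmerClassGroupCriterion
import HarnessLib

/-!
# Route `AdditiveBranchIMC` (rung K1), crux `GordTwoRankOne` (item 19358): the Heegner–Kolyvagin road,
# Part 16 — the small-image input «Conjecture A at the twist» made CERTIFICATE-SHAPED: Deo–Ray–Sujatha 2023
# Thm 3.9 (class number and local `p`-torsion of the `p`-division field) and Coates–Sujatha 2005 Thm 3.4
# (classical `μ = 0` of the `p`-division field), both tree facts (lane `bsd-addord-k1-c3x`, gen 2; `--supports` only)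

HONEST FRAMING. THEOREMS ONLY: no definition, no new named fact, no `sorry`; nothing is booked; the crux
stays OPEN; «BSD is not proved by any of this». Part 14 reduced the crux on the SMALL-IMAGE rank-one rows of
cell (G-ord, `e = 2`) (`E[p]` irreducible, `ρ̄_{E,p^n}` not onto for some `n`) to PUBLISHED facts + STEP L′
on those rows (`hLsm`) + Coates–Sujatha's Conjecture A at the Friedberg–Hoffstein twist `Wd` (`hAsm`: the
dual fine Selmer group of `Wd` over `ℚ^cyc` is finitely generated over `ℤ_p`). Conjecture A is OPEN in
general, but the tree carries two PUBLISHED sufficient conditions as named facts: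
* `DeoRaySujatha2023.thm39_fineSelmerDual_moduleFinite_of_classNumber_divisionField` — `p ≠ 2`, `E[p]`
  irreducible, `p ∤ #Gal(ℚ(E[p])/ℚ)`, `p ∤ h(ℚ(E[p]))`, and no non-zero decomposition-fixed `p`-torsion at
  `p` and at the bad places ⟹ (A). On the small-image rows the FIRST condition is AUTOMATIC in substance (the
  image is contained in the normaliser of a Cartan subgroup or is projectively `𝔖₄`, of order prime to `p`)
  — kept here as a displayed hypothesis, since the tree has no image-size census lemma for `#Gal(ℚ(E[p])/ℚ)`;
  the class-number and local conditions are PER-PAIR CERTIFICATES (degree `≤ 2(p²−1)` fields; `≤ 16` at `p = 3`).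
* `CoatesSujatha2005.thm34_fineSelmerDual_moduleFinite_of_classicalMuVanishes_divisionField` — classical
  `μ = 0` for the cyclotomic `ℤ_p`-extension of `ℚ(E[p])` ⟹ (A).
THIS FILE composes them with Part 14's class theorem:
* `cellGordTwo_missingLowerBoundAt_rankOne_of_smallImage_of_adjustedIndexBound_of_classNumber` — PUB (incl.
  `hDRS`) + `hLsm` + `hClsm` (per twist: `p ∤ #Gal(ℚ(Wd[p])/ℚ)`, `p ∤ h(ℚ(Wd[p]))`, local no-fixed-`p`-torsion)
  ⟹ the crux's conclusion on the small-image rows;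
* `cellGordTwo_missingLowerBoundAt_rankOne_of_smallImage_of_adjustedIndexBound_of_classicalMu` — PUB (incl.
  `hCS`) + `hLsm` + `hMusm` (classical `μ = 0` of `ℚ(Wd[p])^cyc`) ⟹ the same.
So on these rows the small-image input is either a CLASS-NUMBER CERTIFICATE per pair or Iwasawa's classical
`μ = 0` for one explicit number field; the rank-one input stays STEP L′. Nothing booked.

References: [DeoRaySujatha2023] Thm. 3.8/3.9 (b), Lemma 5.1; [CoatesSujatha2005] Thm. 3.4, statement (A);
[KuriharaPollack2007] §3.1; [Kato2004Asterisque] Thm. 14.5 (3); [JetchevSkinnerWan2017] §7.4.1;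
[Miller2011LMS] Def. 1.1.
-/

set_option autoImplicit false
set_option linter.dupNamespace false
noncomputable section

open scoped Classical NumberField
open WeierstrassCurve NumberField IsDedekindDomain
  Literature.NumberTheory.EllipticCurves Literature.NumberTheory.EllipticCurves.ModularForms
  Literature.NumberTheory.EllipticCurves.Rank1Residual
  Literature.NumberTheory.EllipticCurves.Rank1Residual.Typed
  Literature.NumberTheory.IwasawaTheory
  Summit.BirchSwinnertonDyer.Rank1Residual
  Summit.BirchSwinnertonDyer.Rank1Residual.Additive
  Summit.BirchSwinnertonDyer.Rank1Residual.X11b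
  Summit.BirchSwinnertonDyer.Rank1Residual.GaloisImage
  Literature.NumberTheory.Automorphic
  Summit.BirchSwinnertonDyer.BirchSwinnertonDyer.Theses.AdditiveBranchIMC

namespace Summit.BirchSwinnertonDyer.BirchSwinnertonDyer.Theorems.AdditiveBranchIMCGordTwoRankOne.HeegnerKolyvagin

/-! ### §34 Conjecture A at the twist from the `p`-division field (Deo–Ray–Sujatha / Coates–Sujatha) -/

/-- **The crux's conclusion on the SMALL-IMAGE rows from PUBLISHED facts + STEP L′ + a CLASS-NUMBER
certificate for the twist's `p`-division field.** Part 14's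
`cellGordTwo_missingLowerBoundAt_rankOne_of_smallImage_of_adjustedIndexBound_of_conjA` with `hAsm`
DISCHARGED by Deo–Ray–Sujatha 2023 Thm 3.9 (tree fact `hDRS`) from the displayed per-twist data `hClsm`: for
every Friedberg–Hoffstein-type twist `Wd` of a small-image rank-one row, (i) `p ∤ #Gal(ℚ(Wd[p])/ℚ)` (in
substance automatic on these rows: Cartan-normaliser or projectively `𝔖₄` image), (ii) `p ∤ h(ℚ(Wd[p]))`,
(iii) no non-zero `p`-torsion point of `Wd` fixed by a decomposition group at `p` or at a bad place — a
PER-PAIR CERTIFICATE (`Wd[p]` irreducible is derived: x11b `hasIrreducibleModPGaloisRep_twist_model`).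
PUBLISHED binders: `hGZ`, `hKo`, `hKatoI`, `hDRS`, `hGZK`, `hmod`, `hnf`, `hmodP`, `hFH`; OPEN: `hLsm` (STEP L′
on the small-image rows). Nothing booked. [cite: DeoRaySujatha2023, §3 Thm. 3.8, Thm. 3.9 (b) and §5 Lemma 5.1]
[cite: Kato2004Asterisque, Thm. 14.5 (3) (p. 236) and Prop. 14.16 (2)] [cite: JetchevSkinnerWan2017, §7.4.1 (pp. 29–31)]
[cite: Miller2011LMS, Def. 1.1] -/
theorem cellGordTwo_missingLowerBoundAt_rankOne_of_smallImage_of_adjustedIndexBound_of_classNumber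
    (hGZ : ∀ (N : ℕ) [NeZero N] (W : WeierstrassCurve ℚ) (K : Type) [Field K] [NumberField K],
      gross_zagier N W K)
    (hKo : ∀ (N : ℕ) [NeZero N] (W : WeierstrassCurve ℚ) (K : Type) [Field K] [NumberField K],
      kolyvagin N W K)
    (hKatoI : Kato2004.rankZero_padicValNat_sha_add_padicValNat_tamagawa_le_of_additive_potGood_of_irreducible_of_fineSelmerDual_fg)
    (hDRS : DeoRaySujatha2023.thm39_fineSelmerDual_moduleFinite_of_classNumber_divisionField)
    (hGZK : rank_eq_analyticRank_of_analyticRank_le_one) (hmod : hasEntireLFunction_rat)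
    (hnf : exists_isNewformOf) (hmodP : nonempty_modularParametrizationData)
    (hFH : friedbergHoffstein_exists_heegnerField_split_twist_ne_zero)
    (hLsm : ∀ (W : WeierstrassCurve ℚ) [W.IsElliptic] [W.IsGloballyMinimal] (p : ℕ) [Fact p.Prime]
      (N : ℕ) [NeZero N] (K : Type) [Field K] [NumberField K]
      (Dt : ModularParametrizationData W N) (H : HeegnerDatum N (NumberField.discr K)) (ι : K →+* ℂ)
      (P : (W.baseChange K).toAffine.Point)
      (Wd : WeierstrassCurve ℚ) [Wd.IsElliptic] [Wd.IsGloballyMinimal] (Cd : VariableChange ℚ),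
      W.analyticRank = 1 → N10.CellGordTwo W p → W.HasIrreducibleModPGaloisRep p →
      ¬ (∀ n : ℕ, W.HasSurjectiveModNGaloisRep (p ^ n : ℕ)) →
      W.conductorNorm ℤ = N → IsImaginaryQuadratic K → SatisfiesHeegnerHypothesis N K →
      WeierstrassCurve.Affine.Point.map ι.toRatAlgHom P = heegnerPointComplex Dt H →
      Cd • W.quadraticTwist (NumberField.discr K : ℚ) = Wd →
      Finite (W.baseChange K).sha →
      (2 * padicValNat p (AddSubgroup.zmultiples P).index : ℤ) ≤
        padicValNat p (W.baseChange K).shaOrder + padicValNat p W.tamagawaProduct +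
          padicValNat p Wd.tamagawaProduct + 2 * padicValRat p (Dt.c : ℚ))
    (hClsm : ∀ (W : WeierstrassCurve ℚ) [W.IsElliptic] [W.IsGloballyMinimal] (p : ℕ) [Fact p.Prime]
      (K : Type) [Field K] [NumberField K]
      (Wd : WeierstrassCurve ℚ) [Wd.IsElliptic] [Wd.IsGloballyMinimal] (Cd : VariableChange ℚ),
      W.analyticRank = 1 → N10.CellGordTwo W p → W.HasIrreducibleModPGaloisRep p →
      ¬ (∀ n : ℕ, W.HasSurjectiveModNGaloisRep (p ^ n : ℕ)) →
      IsImaginaryQuadratic K → SatisfiesHeegnerHypothesis (W.conductorNorm ℤ) K →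
      (W.quadraticTwist (NumberField.discr K : ℚ)).entireLFunction 1 ≠ 0 →
      Cd • W.quadraticTwist (NumberField.discr K : ℚ) = Wd →
      (haveI : NeZero p := ⟨(Fact.out : p.Prime).ne_zero⟩
       ¬ p ∣ Nat.card ((Wd.divisionField p) ≃ₐ[ℚ] (Wd.divisionField p))) ∧
      (haveI : NeZero p := ⟨(Fact.out : p.Prime).ne_zero⟩
       haveI : NumberField (Wd.divisionField p) := NumberField.mk
       ¬ p ∣ NumberField.classNumber (Wd.divisionField p)) ∧
      (∀ v : HeightOneSpectrum (𝓞 ℚ), (((p : ℕ) : 𝓞 ℚ) ∈ v.asIdeal ∨ ¬ Wd.HasGoodReductionAt v) →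
        ∀ x : Wd.geomPrimaryTorsion p, p • x = 0 →
          (∀ d ∈ Literature.NumberTheory.EllipticCurves.GreenbergSelmer.decomp v, d • x = x) → x = 0)) :
    ∀ (W : WeierstrassCurve ℚ) [W.IsElliptic] [W.IsGloballyMinimal] (p : ℕ) [Fact p.Prime],
      W.analyticRank = 1 → N10.CellGordTwo W p → W.HasIrreducibleModPGaloisRep p →
      ¬ (∀ n : ℕ, W.HasSurjectiveModNGaloisRep (p ^ n : ℕ)) → Typed.MissingLowerBoundAt W p := by
  refine cellGordTwo_missingLowerBoundAt_rankOne_of_smallImage_of_adjustedIndexBound_of_conjA hGZ hKo hKatoI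
    hGZK hmod hnf hmodP hFH hLsm ?_
  intro W _ _ p _ K _ _ Wd _ _ Cd hr hc2 hirr hns hK hHN hLt hWd κ hκ
  obtain ⟨hGal, hCl, hloc⟩ := hClsm W p K Wd Cd hr hc2 hirr hns hK hHN hLt hWd
  have hirrd : Wd.HasIrreducibleModPGaloisRep p := hasIrreducibleModPGaloisRep_twist_model W p K hK.1 hirr Cd hWd
  exact hDRS Wd p hc2.1 hirrd hGal hCl hloc κ hκ

/-- **The same with Conjecture A at the twist from the CLASSICAL `μ = 0` of the twist's `p`-division field**
(Coates–Sujatha 2005 Thm 3.4, tree fact `hCS`): PUB + `hLsm` + `hMusm` (for every Friedberg–Hoffstein-type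
twist `Wd` of a small-image rank-one row: `ClassicalMuVanishes` for every cyclotomic `ℤ_p`-extension of
`ℚ(Wd[p])`) ⟹ the crux's conclusion on the small-image rows. Nothing booked.
[cite: CoatesSujatha2005, Thm. 3.4 (§3)] [cite: KuriharaPollack2007, §3.1] [cite: JetchevSkinnerWan2017, §7.4.1 (pp. 29–31)]
[cite: Miller2011LMS, Def. 1.1] -/
theorem cellGordTwo_missingLowerBoundAt_rankOne_of_smallImage_of_adjustedIndexBound_of_classicalMu
    (hGZ : ∀ (N : ℕ) [NeZero N] (W : WeierstrassCurve ℚ) (K : Type) [Field K] [NumberField K],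
      gross_zagier N W K)
    (hKo : ∀ (N : ℕ) [NeZero N] (W : WeierstrassCurve ℚ) (K : Type) [Field K] [NumberField K],
      kolyvagin N W K)
    (hKatoI : Kato2004.rankZero_padicValNat_sha_add_padicValNat_tamagawa_le_of_additive_potGood_of_irreducible_of_fineSelmerDual_fg)
    (hCS : CoatesSujatha2005.thm34_fineSelmerDual_moduleFinite_of_classicalMuVanishes_divisionField)
    (hGZK : rank_eq_analyticRank_of_analyticRank_le_one) (hmod : hasEntireLFunction_rat)
    (hnf : exists_isNewformOf) (hmodP : nonempty_modularParametrizationData)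
    (hFH : friedbergHoffstein_exists_heegnerField_split_twist_ne_zero)
    (hLsm : ∀ (W : WeierstrassCurve ℚ) [W.IsElliptic] [W.IsGloballyMinimal] (p : ℕ) [Fact p.Prime]
      (N : ℕ) [NeZero N] (K : Type) [Field K] [NumberField K]
      (Dt : ModularParametrizationData W N) (H : HeegnerDatum N (NumberField.discr K)) (ι : K →+* ℂ)
      (P : (W.baseChange K).toAffine.Point)
      (Wd : WeierstrassCurve ℚ) [Wd.IsElliptic] [Wd.IsGloballyMinimal] (Cd : VariableChange ℚ),
      W.analyticRank = 1 → N10.CellGordTwo W p → W.HasIrreducibleModPGaloisRep p →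
      ¬ (∀ n : ℕ, W.HasSurjectiveModNGaloisRep (p ^ n : ℕ)) →
      W.conductorNorm ℤ = N → IsImaginaryQuadratic K → SatisfiesHeegnerHypothesis N K →
      WeierstrassCurve.Affine.Point.map ι.toRatAlgHom P = heegnerPointComplex Dt H →
      Cd • W.quadraticTwist (NumberField.discr K : ℚ) = Wd →
      Finite (W.baseChange K).sha →
      (2 * padicValNat p (AddSubgroup.zmultiples P).index : ℤ) ≤
        padicValNat p (W.baseChange K).shaOrder + padicValNat p W.tamagawaProduct +
          padicValNat p Wd.tamagawaProduct + 2 * padicValRat p (Dt.c : ℚ))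
    (hMusm : ∀ (W : WeierstrassCurve ℚ) [W.IsElliptic] [W.IsGloballyMinimal] (p : ℕ) [Fact p.Prime]
      (K : Type) [Field K] [NumberField K]
      (Wd : WeierstrassCurve ℚ) [Wd.IsElliptic] [Wd.IsGloballyMinimal] (Cd : VariableChange ℚ),
      W.analyticRank = 1 → N10.CellGordTwo W p → W.HasIrreducibleModPGaloisRep p →
      ¬ (∀ n : ℕ, W.HasSurjectiveModNGaloisRep (p ^ n : ℕ)) →
      IsImaginaryQuadratic K → SatisfiesHeegnerHypothesis (W.conductorNorm ℤ) K →
      (W.quadraticTwist (NumberField.discr K : ℚ)).entireLFunction 1 ≠ 0 →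
      Cd • W.quadraticTwist (NumberField.discr K : ℚ) = Wd →
      (haveI : NeZero p := ⟨(Fact.out : p.Prime).ne_zero⟩
       ∀ κL : ZpExtension (Wd.divisionField p) p, κL.IsCyclotomic → ClassicalMuVanishes κL)) :
    ∀ (W : WeierstrassCurve ℚ) [W.IsElliptic] [W.IsGloballyMinimal] (p : ℕ) [Fact p.Prime],
      W.analyticRank = 1 → N10.CellGordTwo W p → W.HasIrreducibleModPGaloisRep p →
      ¬ (∀ n : ℕ, W.HasSurjectiveModNGaloisRep (p ^ n : ℕ)) → Typed.MissingLowerBoundAt W p := by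
  refine cellGordTwo_missingLowerBoundAt_rankOne_of_smallImage_of_adjustedIndexBound_of_conjA hGZ hKo hKatoI
    hGZK hmod hnf hmodP hFH hLsm ?_
  intro W _ _ p _ K _ _ Wd _ _ Cd hr hc2 hirr hns hK hHN hLt hWd κ hκ
  exact hCS Wd p hc2.1 (hMusm W p K Wd Cd hr hc2 hirr hns hK hHN hLt hWd) κ hκ

end Summit.BirchSwinnertonDyer.BirchSwinnertonDyer.Theorems.AdditiveBranchIMCGordTwoRankOne.HeegnerKolyvagin

end
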